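import Literature.NumberTheory.EllipticCurves.CongruenceVisibilityMultiplicativeTwisted
import Literature.NumberTheory.EllipticCurves.SelmerImage
import Literature.NumberTheory.EllipticCurves.BSDRankZeroDensity
import HarnessLib

/-!
# Route (3e) SELMER COMPANION, I: the upper-bound congruence transport
# `#Sel^(p)(E/K) ≤ #Sel^(p)(A/K) · ∏_v ι_v(θ)` along a `Γ_K`-isomorphism `θ : E[p] ≅ A[p]`
# (cell `b2b-bsdres`, unit `b2b-bsdres-x11a`, gen 26; class X11a = N7)

HONEST FRAMING (run/shared/lean/b2b/bsd-rank1-residual/, verbatim in every file): the goal of the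
cell is to DELETE the COMBINATION-SHAPED residual classes of the Birch–Swinnerton-Dyer formula for
ALL analytic-rank `≤ 1` elliptic curves over `ℚ` — "full BSD formula for every rank `≤ 1` curve in
class `C`" assembled STRICTLY from published theorems — so that the rank-`≤ 1` remainder becomes
exactly the CONSTRUCTION-SHAPED classes, which are TYPED (missing-input `Prop`s), NOT attempted.
This is not "finishing BSD". CLASS-OWNERS.md: research routes; NO CLAIM BEYOND STATED CLASSES.
THEOREMS ONLY (no definition, no named fact, no `sorry`); nothing is booked by this file; no label
moves. General (any number field `K : Type`, any odd prime `p`) and cell-independent.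

## What this file proves

The tree's visibility files (`Literature/…/CongruenceVisibility*.lean`, x11a gens 9–10) prove the
LOWER-bound half of the comparison of the two Kummer Selmer structures on one Galois module
`E'[p] ≅ E[p]`: a `p`-congruent curve of LARGER Mordell–Weil rank forces `Ш(E/K)[p] ≠ 0`
("visibility"). This file proves the UPPER-bound half ("invisibility"): for elliptic curves
`E' = W'`, `E = W` over a number field `K`, an odd prime `p`, a `Γ_K`-equivariant isomorphism
`θ : E'[p] ≃ E[p]` with transport `θ_* = h1Equiv θ` on `H¹(K, ·)`, and a finite set `S` of finite
places containing every place of bad reduction of `E` or `E'` and every place above `p`,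

  **`#Sel^(p)(E'/K) ≤ #Sel^(p)(E/K) · ∏_{v ∈ S} ι_v(θ)`**   (`natCard_selmerGroup_le_of_congr`)

where `ι_v(θ) = [θ_* 𝓢_v(E') : θ_* 𝓢_v(E') ∩ 𝓢_v(E)]` is the comparison index of the local
Selmer conditions at `v` (`𝓢_v(·) = selmerLocalKer · K_v p`, the global classes dying in
`H¹(K_v, ·)`; `CongruenceVisibilityComparison.lean`). Proof: the subgroup
`B = {c ∈ Sel^(p)(E') : θ_* c ∈ 𝓢_v(E) for all v ∈ S}` has index `≤ ∏_{v ∈ S} ι_v(θ)` in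
`Sel^(p)(E')` (because `Sel^(p)(E') ≤ 𝓢_v(E')`), and `θ_*` maps `B` injectively INTO `Sel^(p)(E)`:
at `v ∈ S` by the definition of `B`; at a finite `v ∉ S` both local conditions are "unramified at
`v`" (good reduction, `v ∤ p`: Gross 1991 (7.1), tree `selmerLocalKer_eq_unramifiedKer`,
`unramifiedKer_le_selmerLocalKer`) and unramifiedness passes through `θ`
(`mem_unramifiedKer_iff_h1Equiv_mem`); at an infinite place every class of `H¹(K, E[p])` satisfies
the local condition, since its image `x ∈ H¹(K, E)` has `2x ↦ 0` in `H¹(K_w, E)`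
(`two_nsmul_mem_localRestrictionKer_infinitePlace`) and `px = 0` (`zsmul_galH1Torsion_eq_zero`)
with `p` odd (`selmerLocalKer_eq_comap`). Hence `#Sel^(p)(E') = [Sel^(p)(E') : B] · #B ≤
(∏ ι_v) · #Sel^(p)(E)`. The per-place criteria for `ι_v(θ) = 1` are the tree's
(`relIndex_map_selmerLocalKer_eq_one_of_hasGoodReductionAt / _of_natCard_eq_one /
_of_card_torsion_eq_one / _of_hasSplitMultiplicativeReductionAt / _of_hasMultiplicativeReductionAt`)
and `ι_v(θ) ≤ #𝓛_v(E')` always (`relIndex_map_selmerLocalKer_ne_zero_and_le`), which gives the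
hybrid form `natCard_selmerGroup_le_of_congr_of_le_off` and the form with the four kinds of places
met in practice `natCard_selmerGroup_le_of_congr_of_places` (kinds: `v ∤ p` with `E'(K_v)[p] = 0`;
both curves split multiplicative at `v` with `#E(K_v)[p] ≤ p` [Tate, `hU`]; both multiplicative of
the same twist type at `v` with `μ_p(K_v) = 1` [twisted Tate, `hU2`]; anything else at the crude
cost `#𝓛_v(E') = #E'(K_v)[p] · #(𝓞_v/p)`).

USE (companion file `X11a/SelmerCompanionRoute.lean`): with `E'` a rank-`0` curve and `E = A` a
`p`-congruent partner whose `p`-Selmer group is known to be small (`BSD(A,p)` known, `r(A) ≤ 1`,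
`p ∤ #Ш(A)_an`), the bound `#Sel^(p)(E'/ℚ) ≤ p` and the Cassels–Tate parity
(`exists_selmerRank_eq_add`) force `Sel^(p)(E'/ℚ) = 0`, hence `Ш(E'/ℚ)[p] = 0`, hence `BSD(E',p)`
when `p ∤ #Ш(E')_an` — route (3e) of class X11a = N7, valid at EVERY odd `p` (also `p = 3`, where the
Emerton–Pollack–Weston routes (3a)/(3d) are not typed), with NO main conjecture, NO `μ`-invariant and
NO Tamagawa / anomalous-prime condition on the partner.

## Provenance (folklore; proved, not cited)

B. Mazur, K. Rubin, *Kolyvagin systems*, Mem. AMS 799 (2004), §2.3 (for Selmer structures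
`𝓕, 𝓖` on one module, `[H¹_𝓖 : H¹_{𝓕∩𝓖}] ≤ ∏_v [𝓖_v : 𝓕_v ∩ 𝓖_v]`); B. Mazur, K. Rubin, *Ranks
of twists of elliptic curves and Hilbert's tenth problem*, Invent. Math. 181 (2010), Lemma 3.2 /
Prop. 1.3 (the same count for `E[2] = E^χ[2]`); B. Mazur, K. Rubin, *Selmer companion curves*,
Trans. AMS 367 (2015) (`p`-Selmer near-companions: `|d_p(E^χ) − d_p(A^χ)|` bounded along
`E[p] ≅ A[p]`). We know no numbered printed statement with the local kinds needed at `p ∣ N`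
(presearch, NOTES.md of the unit), so the count is PROVED here from the tree's Galois-cohomology
library, exactly as its lower-bound twin `exists_sha_ne_zero_of_congr_of_relIndex_lt` was.

## References

* [MazurRubin2004] B. Mazur, K. Rubin, *Kolyvagin systems*, Mem. Amer. Math. Soc. 799 (2004), §2.3.
* B. Mazur, K. Rubin, Invent. Math. 181 (2010), Lemma 3.2; Trans. Amer. Math. Soc. 367 (2015).
* [GrossLMS1991] B. H. Gross, *Kolyvagin's work on modular elliptic curves* (1991), (7.1).
* [MilneADT2006] J. S. Milne, *Arithmetic Duality Theorems*, 2nd ed., I Lemma 3.3, Prop. 3.8.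
* [SilvermanATAEC1994] J. H. Silverman, *Advanced Topics*, Ch. V Thm. 3.1, Lemma 5.2, Thm. 5.3,
  Cor. 5.4 (Tate uniformisation; the named facts `hU`, `hU2`).
* [SerreGaloisCohomology1997] J.-P. Serre, *Galois Cohomology*, I.§2.4 (`H¹(ℝ, ·)` killed by `2`).
* HOME/b2b-bsdres-x11a/REPORT-g26.md (census of the route at `p = 5` and `p = 3`).
-/

set_option autoImplicit false

noncomputable section

open scoped Classical

open WeierstrassCurve Literature.NumberTheory.EllipticCurves
  Literature.NumberTheory.GaloisRepresentations Field NumberField IsDedekindDomain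

namespace Summit.BirchSwinnertonDyer.Rank1Residual.X11a.SelmerCompanion

section Main

variable {K : Type} [Field K] [NumberField K] (W W' : WeierstrassCurve K) [W.IsElliptic]
  [W'.IsElliptic] {p : ℕ} [Fact p.Prime]

omit [W.IsElliptic] [W'.IsElliptic] [Fact p.Prime] in
/-- **At an infinite place every class of `H¹(K, E[p])` satisfies the local Selmer condition, for
`p` odd**: the condition is the preimage of the `H¹(·, E)` condition (`selmerLocalKer_eq_comap`),
`H¹(K_w, E)` kills `2x` for every global `x` (`two_nsmul_mem_localRestrictionKer_infinitePlace`),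
and `H¹(K, E[p])` is killed by `p` (`zsmul_galH1Torsion_eq_zero`).
[cite: SerreGaloisCohomology1997, I.§2.4 Cor. to Prop. 9] -/
theorem mem_selmerLocalKer_infinitePlace_of_odd (hp2 : p ≠ 2) (hp : p.Prime) (w : InfinitePlace K)
    (c : galH1Torsion W (p : ℤ)) : c ∈ selmerLocalKer W w.Completion (p : ℤ) := by
  rw [selmerLocalKer_eq_comap, AddSubgroup.mem_comap]
  set x := torsionH1ToH1 W (p : ℤ) c with hx
  have hpc : p • x = 0 := by
    rw [hx, ← map_nsmul, ← natCast_zsmul, zsmul_galH1Torsion_eq_zero W (p : ℤ) c, map_zero]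
  obtain ⟨k, hk⟩ := hp.odd_of_ne_two hp2
  have h2 := two_nsmul_mem_localRestrictionKer_infinitePlace W w x
  have hck : x = p • x - k • (2 • x) := by
    rw [hk, add_nsmul, one_nsmul, mul_nsmul, add_sub_cancel_left]
  rw [hck, hpc, zero_sub]
  exact neg_mem (AddSubgroup.nsmul_mem _ h2 k)

/-- **The upper-bound congruence transport ("invisibility" count).** Let `E = W`, `E' = W'` be
elliptic curves over a number field `K`, `p` an odd prime, `θ : E'[p] ≃ E[p]` a `Γ_K`-equivariant
isomorphism with transport `θ_* = h1Equiv θ`, and `S` a finite set of finite places containing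
every place of bad reduction of `E` or `E'` and every place above `p`. Then
**`#Sel^(p)(E'/K) ≤ #Sel^(p)(E/K) · ∏_{v ∈ S} ι_v(θ)`**, where
`ι_v(θ) = [θ_* 𝓢_v(E') : θ_* 𝓢_v(E') ∩ 𝓢_v(E)]` is the comparison index of the local Selmer
conditions (`𝓢_v(·) = selmerLocalKer · K_v p`). Proof in the module docstring: the classes of
`Sel^(p)(E')` whose transport satisfies the local condition of `E` at every `v ∈ S` form a subgroup
of index `≤ ∏ ι_v(θ)`, mapped injectively into `Sel^(p)(E)` by `θ_*` (places outside `S`: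
unramified conditions; infinite places: `p` odd). The twin of the tree's visibility count
`exists_sha_ne_zero_of_congr_of_relIndex_lt`, with the roles of the two Selmer structures exchanged.
[cite: MazurRubin2004, §2.3] [cite: GrossLMS1991, §7 (7.1)] -/
theorem natCard_selmerGroup_le_of_congr (hp2 : p ≠ 2)
    (θ : geomTorsion W' (p : ℤ) ≃+ geomTorsion W (p : ℤ))
    (hθ : ∀ (σ : absoluteGaloisGroup K) (P : geomTorsion W' (p : ℤ)), θ (σ • P) = σ • θ P)
    (S : Finset (HeightOneSpectrum (𝓞 K)))
    (hS : ∀ v : HeightOneSpectrum (𝓞 K), v ∉ S →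
      W.HasGoodReductionAt v ∧ W'.HasGoodReductionAt v ∧ (p : 𝓞 K) ∉ v.asIdeal) :
    Nat.card (W'.selmerGroup (p : ℤ)) ≤
      Nat.card (W.selmerGroup (p : ℤ)) *
        ∏ v ∈ S, (selmerLocalKer W (v.adicCompletion K) (p : ℤ)).relIndex
          ((selmerLocalKer W' (v.adicCompletion K) (p : ℤ)).map (h1Equiv θ hθ).toAddMonoidHom) := by
  have hp : p.Prime := Fact.out
  have hn : (p : ℤ) ≠ 0 := by exact_mod_cast hp.ne_zero
  haveI hSelfin : Finite (W.selmerGroup (p : ℤ)) := W.finite_selmerGroup_holds hn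
  haveI hSel'fin : Finite (W'.selmerGroup (p : ℤ)) := W'.finite_selmerGroup_holds hn
  -- `j = θ_* ∘ (Sel^(p)(E') ↪ H¹(K, E'[p]))`, `D v = j⁻¹ 𝓢_v(E)`, `B = ⋂_{v ∈ S} D v ≤ Sel^(p)(E')`
  set j : W'.selmerGroup (p : ℤ) →+ galH1Torsion W (p : ℤ) :=
    (h1Equiv θ hθ).toAddMonoidHom.comp (W'.selmerGroup (p : ℤ)).subtype with hj
  have hj_apply : ∀ c : W'.selmerGroup (p : ℤ), j c = h1Equiv θ hθ (c : galH1Torsion W' (p : ℤ)) :=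
    fun c ↦ rfl
  set D : ∀ v : HeightOneSpectrum (𝓞 K), AddSubgroup (W'.selmerGroup (p : ℤ)) :=
    fun v ↦ (selmerLocalKer W (v.adicCompletion K) (p : ℤ)).comap j with hD
  have hD_mem : ∀ v c, c ∈ D v ↔
      h1Equiv θ hθ (c : galH1Torsion W' (p : ℤ)) ∈ selmerLocalKer W (v.adicCompletion K) (p : ℤ) :=
    fun v c ↦ Iff.rfl
  set B : AddSubgroup (W'.selmerGroup (p : ℤ)) := ⨅ v : S, D v with hB
  -- (1) `[Sel^(p)(E') : D v] ≤ ι_v(θ)` (as `Sel^(p)(E') ≤ 𝓢_v(E')`), hence `[Sel^(p)(E') : B] ≤ ∏ ι_v(θ)`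
  have hrange : ∀ v : HeightOneSpectrum (𝓞 K), j.range ≤
      (selmerLocalKer W' (v.adicCompletion K) (p : ℤ)).map (h1Equiv θ hθ).toAddMonoidHom := by
    rintro v _ ⟨c, rfl⟩
    exact AddSubgroup.mem_map.mpr ⟨c, ((mem_selmerGroup_iff W' _ _).mp c.2).1 v, rfl⟩
  have hDidx : ∀ v : HeightOneSpectrum (𝓞 K),
      (D v).index ≤ (selmerLocalKer W (v.adicCompletion K) (p : ℤ)).relIndex
          ((selmerLocalKer W' (v.adicCompletion K) (p : ℤ)).map (h1Equiv θ hθ).toAddMonoidHom) ∧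
        (D v).index ≠ 0 := by
    intro v
    have hne := (relIndex_map_selmerLocalKer_ne_zero_and_le W W' θ hθ v).1
    rw [hD, AddSubgroup.index_comap]
    exact ⟨AddSubgroup.relIndex_le_of_le_right (hrange v) hne,
      fun h0 ↦ hne (AddSubgroup.relIndex_eq_zero_of_le_right (hrange v) h0)⟩
  have hBle : B.index ≤ ∏ v ∈ S, (selmerLocalKer W (v.adicCompletion K) (p : ℤ)).relIndex
      ((selmerLocalKer W' (v.adicCompletion K) (p : ℤ)).map (h1Equiv θ hθ).toAddMonoidHom) := by
    refine (AddSubgroup.index_iInf_le _).trans ?_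
    rw [← Finset.prod_coe_sort S]
    exact Finset.prod_le_prod' fun v _ ↦ (hDidx v).1
  -- (2) `θ_*` maps `B` injectively into `Sel^(p)(E)`
  have hmem : ∀ b : W'.selmerGroup (p : ℤ), b ∈ B → j b ∈ W.selmerGroup (p : ℤ) := by
    intro b hb
    rw [hB, AddSubgroup.mem_iInf] at hb
    rw [hj_apply, mem_selmerGroup_iff]
    refine ⟨fun v ↦ ?_, fun w ↦ mem_selmerLocalKer_infinitePlace_of_odd W hp2 hp w _⟩
    by_cases hv : v ∈ S
    · exact (hD_mem v b).mp (hb ⟨v, hv⟩)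
    · obtain ⟨hgood, hgood', hpv⟩ := hS v hv
      have hpv' : ((p : ℤ) : 𝓞 K) ∉ v.asIdeal := by rwa [Int.cast_natCast]
      obtain ⟨𝔓, h𝔓⟩ := v.primesAbove_nonempty
      refine W.unramifiedKer_le_selmerLocalKer hgood hpv' h𝔓 ?_
      rw [← mem_unramifiedKer_iff_h1Equiv_mem, ← W'.selmerLocalKer_eq_unramifiedKer hgood' hpv' h𝔓]
      exact ((mem_selmerGroup_iff W' _ _).mp b.2).1 v
  have hfinj : Function.Injective (fun b : B ↦ (⟨j b, hmem b b.2⟩ : W.selmerGroup (p : ℤ))) := by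
    intro b₁ b₂ h
    have h1 : j b₁ = j b₂ := congrArg Subtype.val h
    rw [hj_apply, hj_apply] at h1
    exact Subtype.ext (Subtype.ext ((h1Equiv θ hθ).injective h1))
  have hcardB : Nat.card B ≤ Nat.card (W.selmerGroup (p : ℤ)) :=
    Nat.card_le_card_of_injective _ hfinj
  -- (3) `#Sel^(p)(E') = [Sel^(p)(E') : B] · #B`
  calc Nat.card (W'.selmerGroup (p : ℤ)) = B.index * Nat.card B := (AddSubgroup.index_mul_card B).symm
    _ ≤ (∏ v ∈ S, (selmerLocalKer W (v.adicCompletion K) (p : ℤ)).relIndex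
          ((selmerLocalKer W' (v.adicCompletion K) (p : ℤ)).map (h1Equiv θ hθ).toAddMonoidHom)) *
        Nat.card (W.selmerGroup (p : ℤ)) := Nat.mul_le_mul hBle hcardB
    _ = _ := mul_comm _ _

/-- **Hybrid form.** With `θ`, `S` as in `natCard_selmerGroup_le_of_congr` and `T ⊆ S`: if the local
conditions agree along `θ` at the places of `S \ T` (`θ_* 𝓢_v(E') ≤ 𝓢_v(E)`, i.e. `ι_v(θ) = 1`),
then `#Sel^(p)(E'/K) ≤ #Sel^(p)(E/K) · ∏_{v ∈ T} #𝓛_v(E')` (`ι_v(θ) ≤ #𝓛_v(E')` on `T`,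
`relIndex_map_selmerLocalKer_ne_zero_and_le`; `#𝓛_v(E') = #E'(K_v)[p] · #(𝓞_v/p)`,
`natCard_kummerLocalConditionAt_adicCompletion`). [cite: MazurRubin2004, §2.3] -/
theorem natCard_selmerGroup_le_of_congr_of_le_off (hp2 : p ≠ 2)
    (θ : geomTorsion W' (p : ℤ) ≃+ geomTorsion W (p : ℤ))
    (hθ : ∀ (σ : absoluteGaloisGroup K) (P : geomTorsion W' (p : ℤ)), θ (σ • P) = σ • θ P)
    (S T : Finset (HeightOneSpectrum (𝓞 K))) (hTS : T ⊆ S)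
    (hS : ∀ v : HeightOneSpectrum (𝓞 K), v ∉ S →
      W.HasGoodReductionAt v ∧ W'.HasGoodReductionAt v ∧ (p : 𝓞 K) ∉ v.asIdeal)
    (hagree : ∀ v ∈ S, v ∉ T → ∀ c ∈ selmerLocalKer W' (v.adicCompletion K) (p : ℤ),
      h1Equiv θ hθ c ∈ selmerLocalKer W (v.adicCompletion K) (p : ℤ)) :
    Nat.card (W'.selmerGroup (p : ℤ)) ≤
      Nat.card (W.selmerGroup (p : ℤ)) *
        ∏ v ∈ T, Nat.card (W'.kummerLocalConditionAt (p : ℤ) (v.adicCompletion K)) := by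
  refine (natCard_selmerGroup_le_of_congr W W' hp2 θ hθ S hS).trans (Nat.mul_le_mul_left _ ?_)
  rw [← Finset.prod_sdiff hTS, Finset.prod_eq_one (s := S \ T) (fun v hv ↦ ?_), one_mul]
  · exact Finset.prod_le_prod' fun v _ ↦ (relIndex_map_selmerLocalKer_ne_zero_and_le W W' θ hθ v).2
  · rw [Finset.mem_sdiff] at hv
    exact (relIndex_map_selmerLocalKer_eq_one_iff W W' θ hθ).mpr (hagree v hv.1 hv.2)

/-- **The form met in practice: four kinds of places.** Let `p` be an odd prime, `θ : E'[p] ⥲ E[p]`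
a `Γ_K`-isomorphism, `S` a finite set of finite places outside which `E, E'` have good reduction and
which contains the places above `p`, and `T ⊆ S`. Suppose every `v ∈ S \ T` is of one of three
kinds: (i) `v ∤ p` and `E'(K_v)[p] = 0`; (ii) both curves split multiplicative at `v` with
`#E(K_v)[p] ≤ p`; (iii) both curves multiplicative at `v` with `γ(E) = r² γ(E')` in `K_v`
(`γ = −c₄/c₆`: the same twist type) and `μ_p(K_v) = 1`. Then
`#Sel^(p)(E'/K) ≤ #Sel^(p)(E/K) · ∏_{v ∈ T} #E'(K_v)[p] · #(𝓞_v/p)` (the agreement at places of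
kinds (i)–(iii) is the tree's `relIndex_map_selmerLocalKer_eq_one_of_card_torsion_eq_one` /
`h1Equiv_mem_selmerLocalKer_of_hasSplitMultiplicativeReductionAt` [Tate, `hU`] /
`h1Equiv_mem_selmerLocalKer_of_hasMultiplicativeReductionAt` [twisted Tate, `hU2`]). CONDITIONAL on
the two Tate-uniformisation named facts when kinds (ii)/(iii) occur.
[cite: MazurRubin2004, §2.3] [cite: SilvermanATAEC1994, Ch. V Thm. 3.1, Lemma 5.2, Thm. 5.3, Cor. 5.4]
[cite: MilneADT2006, I Lemma 3.3] -/
theorem natCard_selmerGroup_le_of_congr_of_places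
    (hU : Silverman1994_thmV53_tateUniformisation.{0})
    (hU2 : Silverman1994_thmV53_corV54_tateUniformisation.{0}) (hp2 : p ≠ 2)
    (θ : geomTorsion W' (p : ℤ) ≃+ geomTorsion W (p : ℤ))
    (hθ : ∀ (σ : absoluteGaloisGroup K) (P : geomTorsion W' (p : ℤ)), θ (σ • P) = σ • θ P)
    (S T : Finset (HeightOneSpectrum (𝓞 K))) (hTS : T ⊆ S)
    (hS : ∀ v : HeightOneSpectrum (𝓞 K), v ∉ S →
      W.HasGoodReductionAt v ∧ W'.HasGoodReductionAt v ∧ (p : 𝓞 K) ∉ v.asIdeal)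
    (hplaces : ∀ v ∈ S, v ∉ T →
      ((p : 𝓞 K) ∉ v.asIdeal ∧ Nat.card (nsmulAddMonoidHom p :
          (W'.baseChange (v.adicCompletion K)).toAffine.Point →+ _).ker = 1) ∨
      (W.HasSplitMultiplicativeReductionAt v ∧ W'.HasSplitMultiplicativeReductionAt v ∧
        Nat.card (nsmulAddMonoidHom p :
          (W.baseChange (v.adicCompletion K)).toAffine.Point →+ _).ker ≤ p) ∨
      (W.HasMultiplicativeReductionAt v ∧ W'.HasMultiplicativeReductionAt v ∧
        (∃ r : v.adicCompletion K, algebraMap K (v.adicCompletion K) (-(W.c₄ / W.c₆)) =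
          r ^ 2 * algebraMap K (v.adicCompletion K) (-(W'.c₄ / W'.c₆))) ∧
        (∀ ζ : v.adicCompletion K, ζ ^ p = 1 → ζ = 1))) :
    Nat.card (W'.selmerGroup (p : ℤ)) ≤
      Nat.card (W.selmerGroup (p : ℤ)) *
        ∏ v ∈ T, (Nat.card (nsmulAddMonoidHom p :
            (W'.baseChange (v.adicCompletion K)).toAffine.Point →+ _).ker *
          Nat.card (v.adicCompletionIntegers K ⧸
            Ideal.span {(p : v.adicCompletionIntegers K)})) := by
  have hp : p.Prime := Fact.out
  classical
  -- enlarge `T` by the places of kind (i): they cost a factor `1`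
  set T' := T ∪ S.filter (fun v ↦ (p : 𝓞 K) ∉ v.asIdeal ∧ Nat.card (nsmulAddMonoidHom p :
      (W'.baseChange (v.adicCompletion K)).toAffine.Point →+ _).ker = 1) with hT'
  have hT'S : T' ⊆ S := Finset.union_subset hTS (Finset.filter_subset _ _)
  have h1 := natCard_selmerGroup_le_of_congr_of_le_off W W' hp2 θ hθ S T' hT'S hS
    (fun v hv hvT c hc ↦ ?_)
  · refine h1.trans (Nat.mul_le_mul_left _ (le_of_eq ?_))
    have hsplit : T' = T ∪ (S.filter (fun v ↦ (p : 𝓞 K) ∉ v.asIdeal ∧ Nat.card (nsmulAddMonoidHom p :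
      (W'.baseChange (v.adicCompletion K)).toAffine.Point →+ _).ker = 1) \ T) := by
      rw [hT', Finset.union_sdiff_self_eq_union]
    rw [hsplit, Finset.prod_union Finset.disjoint_sdiff,
      Finset.prod_eq_one (s := _ \ T) (fun v hv ↦ ?_), mul_one]
    · refine Finset.prod_congr rfl fun v _ ↦ ?_
      exact W'.natCard_kummerLocalConditionAt_adicCompletion v hp.ne_zero
    · rw [Finset.mem_sdiff, Finset.mem_filter] at hv
      rw [W'.natCard_kummerLocalConditionAt_adicCompletion v hp.ne_zero, hv.1.2.2, one_mul,
        natCard_quot_adicCompletionIntegers_eq_one hv.1.2.1]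
  · have hvT0 : v ∉ T := fun h ↦ hvT (Finset.mem_union_left _ h)
    have hnot1 : ¬ ((p : 𝓞 K) ∉ v.asIdeal ∧ Nat.card (nsmulAddMonoidHom p :
        (W'.baseChange (v.adicCompletion K)).toAffine.Point →+ _).ker = 1) := fun h ↦
      hvT (Finset.mem_union_right _ (Finset.mem_filter.mpr ⟨hv, h⟩))
    rcases hplaces v hv hvT0 with h1 | ⟨hWv, hW'v, hcard⟩ | ⟨hWv, hW'v, hγ, hμ⟩
    · exact absurd h1 hnot1
    · exact W.h1Equiv_mem_selmerLocalKer_of_hasSplitMultiplicativeReductionAt v hU W' θ hθ hWv hW'v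
        hcard hc
    · exact W.h1Equiv_mem_selmerLocalKer_of_hasMultiplicativeReductionAt v hU2 hp2 W' θ hθ hWv hW'v
        hγ hμ hc

end Main

end Summit.BirchSwinnertonDyer.Rank1Residual.X11a.SelmerCompanion

end
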